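import Mathlib

/-!
# Noncritical Belyi maps on `ℙ¹`, step II: the rational step (Scherr–Zieve, Prop. 8)

Z. Scherr, M. E. Zieve, *Separated Belyi maps*, Math. Res. Lett. **21** (2014) 1389–1406
[cite: ScherrZieve2014], Proposition 8 (arXiv:1310.2555, §3): for a finite set `B ⊂ ℙ¹(ℚ)` and a
point `β ∈ ℙ¹(ℚ) ∖ B` there is `f ∈ ℚ(x)` with branch locus `⊆ {0, 1, ∞}` (a Belyi map),
`f(B) ⊆ {0, 1, ∞}`, and `f(β) ∉ {0, 1, ∞}`.  (Scherr–Zieve also make `f` ramified at every point of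
`B`; we do not need that refinement.  Mochizuki proves the same existence, with a polynomial `f`,
as [NCBelyi] Lemma 2.2.)

Printed proof, followed here: WLOG `B ⊂ ℤ`, `β ∈ ℤ` and `#B ≥ 2`; pick a prime `ℓ` dividing no
`β − γ` (`γ ∈ B`), put `δ := β + ℓ`, `B' := B ∪ {δ} = {b_1, …, b_m}`; partial fractions give nonzero
integers `n_i` with `Σ_i n_i/(x − b_i) = N/Π_i (x − b_i)`, `N ≠ 0` (we take `n_i = Π_{k ≠ i} e_k`,
`e_k = Π_{j ≠ k}(b_k − b_j)`, `N = Π_k e_k`, via Lagrange interpolation of the constant `1`); then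
`f := Π_i (x − b_i)^{n_i}` has `f'/f = N/Π_i(x − b_i)`, so every finite critical point of `f` is a
zero or a pole of `f`; `f(∞) = 1` since `Σ n_i = 0`; `f(β) ≠ 0, ∞` as `β ∉ B'`, and `f(β) ≠ 1`
because the `ℓ`-adic valuation of `f(β) = Π (β − b_i)^{n_i}` is `n_m ≠ 0`.

Main result `NoncriticalBelyi.rational_step`, in the tree's `(p, q) ∈ ℚ[x]²` format for rational
functions on `ℙ¹` (cf. `BelyiLemma.lean`): `p, q` monic coprime of the same positive degree
(`p = Π_{n_i > 0}(x − b_i)^{n_i}`, `q = Π_{n_i < 0}(x − b_i)^{−n_i}`), every `b ∈ B` a root of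
`p·q`, the Wronskian identity `(p'q − pq')·Π = N·p·q` and its consequences: a complex zero of
`p'q − pq'` is a zero of `p` or of `q` (branch values `⊆ {0, 1, ∞}`), and `p(β), q(β), p(β) − q(β),
(p'q − pq')(β)` are all nonzero (`f(β) ∉ {0,1,∞}`, `f` unramified at `β`).  No definitions, no
named facts.
-/

namespace Literature.NumberTheory.DiophantineGeometry

open Polynomial Finset

namespace NoncriticalBelyi

/-! ### Logarithmic derivative of a product of powers of linear factors -/

/-- `(Π_i (x − v_i)^{m_i})' · Π_i (x − v_i) = Π_i (x − v_i)^{m_i} · Σ_i m_i Π_{j ≠ i} (x − v_j)` —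
the polynomial form of `f'/f = Σ m_i/(x − v_i)` (Scherr–Zieve, proof of Prop. 8: "`f'(x)/f(x) =
Σ 2n_i/(x − b_i)`"). [cite: ScherrZieve2014, Prop 8 (proof)] -/
theorem derivative_prod_pow_mul_prod {ι R : Type*} [CommRing R] [DecidableEq ι] (s : Finset ι)
    (v : ι → R) (m : ι → ℕ) :
    derivative (∏ i ∈ s, (X - C (v i)) ^ m i) * ∏ i ∈ s, (X - C (v i)) =
      (∏ i ∈ s, (X - C (v i)) ^ m i) * ∑ i ∈ s, C (m i : R) * ∏ j ∈ s.erase i, (X - C (v j)) := by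
  induction s using Finset.induction_on with
  | empty => simp
  | insert a s ha ih =>
    rw [prod_insert ha, prod_insert ha, sum_insert ha, erase_insert ha, derivative_mul,
      derivative_X_sub_C_pow]
    have hsum : ∑ i ∈ s, C (m i : R) * ∏ j ∈ (insert a s).erase i, (X - C (v j)) =
        (X - C (v a)) * ∑ i ∈ s, C (m i : R) * ∏ j ∈ s.erase i, (X - C (v j)) := by
      rw [mul_sum]
      refine sum_congr rfl fun i hi => ?_
      rw [erase_insert_of_ne (ne_of_mem_of_not_mem hi ha).symm,
        prod_insert (fun h => ha (mem_of_mem_erase h))]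
      ring
    rw [hsum]
    -- `m a = 0` or not: in both cases the identity is the same algebra, using `ih`
    have key : (C (m a : R) * (X - C (v a)) ^ (m a - 1) * ∏ i ∈ s, (X - C (v i)) ^ m i +
        (X - C (v a)) ^ m a * derivative (∏ i ∈ s, (X - C (v i)) ^ m i)) *
        ((X - C (v a)) * ∏ i ∈ s, (X - C (v i))) =
        C (m a : R) * ((X - C (v a)) ^ (m a - 1) * (X - C (v a))) *
          ((∏ i ∈ s, (X - C (v i)) ^ m i) * ∏ i ∈ s, (X - C (v i))) +
        (X - C (v a)) ^ m a * (X - C (v a)) *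
          (derivative (∏ i ∈ s, (X - C (v i)) ^ m i) * ∏ i ∈ s, (X - C (v i))) := by ring
    rw [key, ih]
    rcases Nat.eq_zero_or_pos (m a) with h0 | hpos
    · rw [h0]; simp only [Nat.cast_zero, map_zero, zero_mul, zero_add, pow_zero, one_mul]
      ring
    · have hpow : (X - C (v a)) ^ (m a - 1) * (X - C (v a)) = (X - C (v a)) ^ m a := by
        rw [← pow_succ, Nat.sub_add_cancel hpos]
      rw [hpow]; ring

/-! ### The rational step -/

/-- **Scherr–Zieve, Prop. 8** (for `B ⊂ ℤ`, `β ∈ ℤ ∖ B`; the general `ℙ¹(ℚ)` case reduces to this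
by `x ↦ 1/(x − a)` and an integer scaling, as printed): there are monic coprime `p, q ∈ ℚ[x]` of the
same positive degree such that, for `f = p/q`: every `b ∈ B` is a zero or a pole of `f`; at every
complex zero of `p'q − pq'` the value of `f` is `0` or `∞` (so the branch locus of `f : ℙ¹ → ℙ¹` is
contained in `{0, 1, ∞}`, as `f(∞) = 1`); and `f(β) ∉ {0, 1, ∞}`, `f` unramified at `β`
(`p(β), q(β) ≠ 0`, `p(β) ≠ q(β)`, `(p'q − pq')(β) ≠ 0`). [cite: ScherrZieve2014, Prop 8] -/
theorem rational_step (B : Finset ℤ) (β : ℤ) (hβ : β ∉ B) :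
    ∃ p q : ℚ[X], p.Monic ∧ q.Monic ∧ IsCoprime p q ∧ 0 < p.natDegree ∧
      p.natDegree = q.natDegree ∧
      (∀ b ∈ B, p.eval (b : ℚ) = 0 ∨ q.eval (b : ℚ) = 0) ∧
      (∀ z : ℂ, aeval z (derivative p * q - p * derivative q) = 0 → aeval z p = 0 ∨ aeval z q = 0) ∧
      p.eval (β : ℚ) ≠ 0 ∧ q.eval (β : ℚ) ≠ 0 ∧ p.eval (β : ℚ) ≠ q.eval (β : ℚ) ∧
      (derivative p * q - p * derivative q).eval (β : ℚ) ≠ 0 := by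
  classical
  -- enlarge `B` by a point `c ≠ β` so that `#B' ≥ 2` below
  set Bp : Finset ℤ := insert (β + 1) B with hBp
  have hβBp : ∀ γ ∈ Bp, γ ≠ β := by
    intro γ hγ hγβ
    rw [hBp, mem_insert] at hγ
    rcases hγ with h | h
    · omega
    · exact hβ (hγβ ▸ h)
  -- a prime `ℓ` dividing no `β − γ`, `γ ∈ Bp`
  obtain ⟨ℓ, hℓM, hℓ⟩ := Nat.exists_infinite_primes (Bp.sum fun γ => (β - γ).natAbs + 1)
  have hℓndvd : ∀ γ ∈ Bp, ¬ (ℓ : ℤ) ∣ β - γ := by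
    intro γ hγ h
    have hne : β - γ ≠ 0 := sub_ne_zero.2 (hβBp γ hγ).symm
    have h1 : (β - γ).natAbs + 1 ≤ ℓ :=
      (single_le_sum (f := fun γ => (β - γ).natAbs + 1) (fun _ _ => Nat.zero_le _) hγ).trans hℓM
    exact hne (Int.eq_zero_of_dvd_of_natAbs_lt_natAbs h (by rw [Int.natAbs_natCast]; omega))
  have hℓp : Prime (ℓ : ℤ) := Nat.prime_iff_prime_int.1 hℓ
  -- `δ := β + ℓ` and `B' := Bp ∪ {δ}`
  set δ : ℤ := β + ℓ with hδ
  have hδBp : δ ∉ Bp := fun h => hℓndvd δ h ⟨-1, by rw [hδ]; ring⟩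
  set B' : Finset ℤ := insert δ Bp with hB'
  have hβB' : ∀ i ∈ B', (β : ℚ) - i ≠ 0 := by
    intro i hi
    rw [sub_ne_zero, ne_eq, Int.cast_inj]
    rcases mem_insert.1 hi with rfl | hi
    · rw [hδ]; have := hℓ.pos; omega
    · exact (hβBp i hi).symm
  have hBB' : B ⊆ B' := fun b hb => mem_insert_of_mem (mem_insert_of_mem hb)
  have hcard : 2 ≤ B'.card := by
    rw [hB', card_insert_of_notMem hδBp]
    have : 0 < Bp.card := card_pos.2 ⟨β + 1, mem_insert_self _ _⟩
    omega
  -- the integers `e_i = Π_{j ≠ i} (i − j)`, `n_i = Π_{k ≠ i} e_k`, `N = Π_k e_k`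
  set e : ℤ → ℤ := fun i => ∏ j ∈ B'.erase i, (i - j) with he
  have he0 : ∀ i ∈ B', e i ≠ 0 := by
    intro i _
    rw [he]; dsimp only
    exact prod_ne_zero_iff.2 fun j hj => sub_ne_zero.2 (ne_of_mem_erase hj).symm
  set n : ℤ → ℤ := fun i => ∏ k ∈ B'.erase i, e k with hn
  have hn0 : ∀ i ∈ B', n i ≠ 0 := by
    intro i _
    rw [hn]; dsimp only
    exact prod_ne_zero_iff.2 fun k hk => he0 k (mem_of_mem_erase hk)
  set N : ℤ := ∏ k ∈ B', e k with hN
  have hN0 : N ≠ 0 := prod_ne_zero_iff.2 he0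
  have hnN : ∀ i ∈ B', n i * e i = N := by
    intro i hi; rw [hn, hN]; dsimp only; rw [prod_erase_mul _ _ hi]
  -- Lagrange: `Σ_i n_i Π_{j ≠ i} (x − j) = N`
  set L : ℤ → ℚ[X] := fun i => X - C (i : ℚ) with hL
  have hlagr : ∑ i ∈ B', C (n i : ℚ) * ∏ j ∈ B'.erase i, L j = C (N : ℚ) := by
    have hinj : Set.InjOn (fun i : ℤ => (i : ℚ)) B' := fun _ _ _ _ h => Int.cast_injective h
    have hsum := Lagrange.sum_basis hinj (card_pos.1 (by omega))
    have hbasis : ∀ i ∈ B', Lagrange.basis B' (fun i : ℤ => (i : ℚ)) i =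
        C ((e i : ℚ)⁻¹) * ∏ j ∈ B'.erase i, L j := by
      intro i _
      rw [Lagrange.basis, he]
      dsimp only
      rw [Int.cast_prod, ← prod_inv_distrib, map_prod, ← prod_mul_distrib]
      refine prod_congr rfl fun j _ => ?_
      rw [Lagrange.basisDivisor, hL, Int.cast_sub]
    calc ∑ i ∈ B', C (n i : ℚ) * ∏ j ∈ B'.erase i, L j
        = ∑ i ∈ B', C (N : ℚ) * Lagrange.basis B' (fun i : ℤ => (i : ℚ)) i := by
          refine sum_congr rfl fun i hi => ?_
          rw [hbasis i hi, ← mul_assoc, ← map_mul]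
          congr 2
          have hei : (e i : ℚ) ≠ 0 := Int.cast_ne_zero.2 (he0 i hi)
          rw [eq_mul_inv_iff_mul_eq₀ hei, ← Int.cast_mul, hnN i hi]
      _ = C (N : ℚ) := by rw [← mul_sum, hsum, mul_one]
  -- `Σ n_i = 0` (coefficient of `x^{m-1}`)
  have hsum0 : ∑ i ∈ B', n i = 0 := by
    have hm : 1 ≤ B'.card - 1 := by omega
    have hcoeff := congrArg (fun P : ℚ[X] => P.coeff (B'.card - 1)) hlagr
    simp only [finsetSum_coeff, coeff_C_mul, coeff_C, Nat.sub_eq_zero_iff_le] at hcoeff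
    rw [if_neg (by omega)] at hcoeff
    have hmonic : ∀ i ∈ B', (∏ j ∈ B'.erase i, L j).Monic ∧
        (∏ j ∈ B'.erase i, L j).natDegree = B'.card - 1 := by
      intro i hi
      refine ⟨monic_prod_of_monic _ _ fun j _ => monic_X_sub_C _, ?_⟩
      rw [natDegree_prod_of_monic _ _ fun j _ => monic_X_sub_C _]
      simp only [hL, natDegree_X_sub_C, sum_const, smul_eq_mul, mul_one, card_erase_of_mem hi]
    have : ∑ i ∈ B', (n i : ℚ) = 0 := by
      rw [← hcoeff]
      refine sum_congr rfl fun i hi => ?_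
      rw [← (hmonic i hi).2, (hmonic i hi).1.coeff_natDegree, mul_one]
    exact_mod_cast this
  -- the exponents `m₊ = n⁺`, `m₋ = n⁻` and the polynomials `p`, `q`
  set mp : ℤ → ℕ := fun i => (n i).toNat with hmp
  set mm : ℤ → ℕ := fun i => (-n i).toNat with hmm
  have hmpmm : ∀ i, (mp i : ℤ) - mm i = n i := fun i => Int.toNat_sub_toNat_neg _
  set p : ℚ[X] := ∏ i ∈ B', L i ^ mp i with hp
  set q : ℚ[X] := ∏ i ∈ B', L i ^ mm i with hq
  set Pi0 : ℚ[X] := ∏ i ∈ B', L i with hPi0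
  have hLmonic : ∀ i, (L i).Monic := fun i => monic_X_sub_C _
  have hpmonic : p.Monic := monic_prod_of_monic _ _ fun i _ => (hLmonic i).pow _
  have hqmonic : q.Monic := monic_prod_of_monic _ _ fun i _ => (hLmonic i).pow _
  have hpdeg : p.natDegree = ∑ i ∈ B', mp i := by
    rw [hp, natDegree_prod_of_monic _ _ fun i _ => (hLmonic i).pow _]
    simp only [hL, natDegree_pow, natDegree_X_sub_C, mul_one]
  have hqdeg : q.natDegree = ∑ i ∈ B', mm i := by
    rw [hq, natDegree_prod_of_monic _ _ fun i _ => (hLmonic i).pow _]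
    simp only [hL, natDegree_pow, natDegree_X_sub_C, mul_one]
  -- the Wronskian identity `(p'q − pq')·Π = N·p·q`
  have hWp := derivative_prod_pow_mul_prod B' (fun i : ℤ => (i : ℚ)) mp
  have hWq := derivative_prod_pow_mul_prod B' (fun i : ℤ => (i : ℚ)) mm
  have hW : (derivative p * q - p * derivative q) * Pi0 = C (N : ℚ) * p * q := by
    have h1 : (derivative p * q - p * derivative q) * Pi0 =
        (derivative p * Pi0) * q - p * (derivative q * Pi0) := by ring
    rw [h1, hp, hq, hPi0, hWp, hWq]
    simp only [hL] at hlagr ⊢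
    have h2 : ∑ i ∈ B', C (mp i : ℚ) * ∏ j ∈ B'.erase i, (X - C (j : ℚ)) -
        ∑ i ∈ B', C (mm i : ℚ) * ∏ j ∈ B'.erase i, (X - C (j : ℚ)) = C (N : ℚ) := by
      rw [← hlagr, ← sum_sub_distrib]
      refine sum_congr rfl fun i _ => ?_
      rw [← sub_mul, ← map_sub]
      congr 2
      exact_mod_cast hmpmm i
    linear_combination (∏ i ∈ B', (X - C (i : ℚ)) ^ mp i) * (∏ i ∈ B', (X - C (i : ℚ)) ^ mm i) * h2
  -- values at `β`
  have hpβ : p.eval (β : ℚ) ≠ 0 := by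
    rw [hp, eval_prod]
    exact prod_ne_zero_iff.2 fun i hi => by simpa [hL] using pow_ne_zero _ (hβB' i hi)
  have hqβ : q.eval (β : ℚ) ≠ 0 := by
    rw [hq, eval_prod]
    exact prod_ne_zero_iff.2 fun i hi => by simpa [hL] using pow_ne_zero _ (hβB' i hi)
  have hPi0β : Pi0.eval (β : ℚ) ≠ 0 := by
    rw [hPi0, eval_prod]
    exact prod_ne_zero_iff.2 fun i hi => by simpa [hL] using hβB' i hi
  -- `p(β)`, `q(β)` are the integers `Π (β − i)^{m i}`; exactly one of them is divisible by `ℓ`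
  have hevalZ : ∀ m : ℤ → ℕ, (∏ i ∈ B', L i ^ m i).eval (β : ℚ) =
      ((∏ i ∈ B', (β - i) ^ m i : ℤ) : ℚ) := by
    intro m
    rw [eval_prod, Int.cast_prod]
    refine prod_congr rfl fun i _ => ?_
    simp [hL]
  have hδB' : δ ∈ B' := mem_insert_self _ _
  have hdvd : ∀ m : ℤ → ℕ, ((ℓ : ℤ) ∣ ∏ i ∈ B', (β - i) ^ m i) ↔ m δ ≠ 0 := by
    intro m
    rw [hℓp.dvd_finsetProd_iff]
    constructor
    · rintro ⟨i, hi, hdi⟩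
      have hdi' := hℓp.dvd_of_dvd_pow hdi
      rcases mem_insert.1 hi with rfl | hi
      · intro h0; rw [h0, pow_zero] at hdi
        exact hℓ.one_lt.ne' (by exact_mod_cast Int.eq_one_of_dvd_one (by omega) hdi)
      · exact absurd hdi' (hℓndvd i hi)
    · intro h
      refine ⟨δ, hδB', ?_⟩
      have : (β - δ) = -(ℓ : ℤ) := by rw [hδ]; ring
      rw [this]
      exact (dvd_neg.2 dvd_rfl).pow h
  have hpq : p.eval (β : ℚ) ≠ q.eval (β : ℚ) := by
    rw [hp, hq, hevalZ, hevalZ, ne_eq, Int.cast_inj]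
    intro h
    have hnδ := hn0 δ hδB'
    have key : (mp δ ≠ 0) ↔ (mm δ ≠ 0) := by rw [← hdvd mp, ← hdvd mm, h]
    simp only [hmp, hmm, ne_eq, Int.toNat_eq_zero, not_le, Int.lt_iff_add_one_le] at key
    omega
  refine ⟨p, q, hpmonic, hqmonic, ?_, ?_, ?_, ?_, ?_, hpβ, hqβ, hpq, ?_⟩
  · -- coprime
    rw [hp, hq]
    refine IsCoprime.prod_left fun i hi => IsCoprime.prod_right fun j hj => ?_
    by_cases hij : i = j
    · subst hij
      rcases Int.lt_trichotomy (n i) 0 with h | h | h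
      · have : mp i = 0 := by rw [hmp]; exact Int.toNat_eq_zero.2 h.le
        rw [this, pow_zero]; exact isCoprime_one_left
      · exact absurd h (hn0 i hi)
      · have : mm i = 0 := by rw [hmm]; exact Int.toNat_eq_zero.2 (by omega)
        rw [this, pow_zero]; exact isCoprime_one_right
    · exact ((pairwise_coprime_X_sub_C (K := ℚ) Int.cast_injective) hij).pow
  · -- `0 < deg p`: some `n_i > 0` since `Σ n_i = 0` and all `n_i ≠ 0`
    rw [hpdeg]
    by_contra h0
    have hall : ∀ i ∈ B', n i < 0 := by
      intro i hi
      have : mp i = 0 := by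
        have := sum_eq_zero_iff.1 (Nat.eq_zero_of_not_pos h0) i hi; exact this
      rw [hmp, Int.toNat_eq_zero] at this
      exact lt_of_le_of_ne this (hn0 i hi)
    have : ∑ i ∈ B', n i < 0 := sum_neg hall (card_pos.1 (by omega))
    rw [hsum0] at this; exact lt_irrefl _ this
  · -- equal degrees
    rw [hpdeg, hqdeg]
    have : (∑ i ∈ B', (mp i : ℤ)) - ∑ i ∈ B', (mm i : ℤ) = 0 := by
      rw [← sum_sub_distrib]; simp_rw [hmpmm]; exact hsum0
    exact_mod_cast sub_eq_zero.1 this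
  · -- `B` maps to `{0, ∞}`
    intro b hb
    have hb' := hBB' hb
    rcases Int.lt_trichotomy (n b) 0 with h | h | h
    · right
      rw [hq, eval_prod]
      refine prod_eq_zero hb' ?_
      have : mm b ≠ 0 := by rw [hmm]; simp only [ne_eq, Int.toNat_eq_zero, not_le]; omega
      simp [hL, this]
    · exact absurd h (hn0 b hb')
    · left
      rw [hp, eval_prod]
      refine prod_eq_zero hb' ?_
      have : mp b ≠ 0 := by rw [hmp]; simp only [ne_eq, Int.toNat_eq_zero, not_le]; omega
      simp [hL, this]
  · -- branch values of finite critical points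
    intro z hz
    have h := congrArg (aeval z) hW
    rw [map_mul, hz, zero_mul, map_mul, map_mul, aeval_C] at h
    have hN' : (algebraMap ℚ ℂ) (N : ℚ) ≠ 0 := by
      rw [map_ne_zero_iff _ (algebraMap ℚ ℂ).injective]; exact_mod_cast hN0
    rcases mul_eq_zero.1 h.symm with h | h
    · rcases mul_eq_zero.1 h with h | h
      · exact absurd h hN'
      · exact Or.inl h
    · exact Or.inr h
  · -- unramified at `β`
    intro h
    have := congrArg (eval (β : ℚ)) hW
    rw [eval_mul, h, zero_mul, eval_mul, eval_mul, eval_C] at this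
    exact mul_ne_zero (mul_ne_zero (Int.cast_ne_zero.2 hN0) hpβ) hqβ this.symm

end NoncriticalBelyi

end Literature.NumberTheory.DiophantineGeometry
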